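import Mathlib
import HarnessLib
import Summits.NavierStokesRegularity.NavierStokesRegularity.Theorems.TaylorModelRungThreeCertificateFormatV

/-!
# Crux K1b-DR (stmt-NavierStokesRegularity-23954), line `taylor-model` — v3 certificate: TEXT-CODED `ℚ(√2)` tables
# (cert2lean-v3 data encoding, companion of `…FormatVText`; successor engine-1 g67)

The v1 static tables (`CertTables QS2`: the structure table `α`, 256 entries, and the effective coefficients `coef`,
`256·m = 5632` entries) exceed what term-level list literals elaborate within the default heartbeat budget. The
generated data modules therefore carry them as ONE STRING LITERAL decoded when the module initialises:
`QS2Text.list "r,r&r,…"`. Grammar: an entry is `A` (the element `A + 0·√2`) or `A&B` (`A + B·√2`); a rational `A` is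
`m`, `m@e`, `m/d` or `m@e/d` (value `m·2^e/d`; decimal integers, optional sign `-` on `m` and `e`, `d ≥ 1`); entries are
separated by `,`; every other character (white space) is ignored. Nothing here carries a claim: the decoded tables are
DATA the checker tests. MODEL-lattice bookkeeping only (rung TL-M3); nothing here is a statement about the Navier–Stokes
equations.
-/

-- the sub-problem namespace repeats the summit name by design (D-0017)
set_option linter.dupNamespace false

namespace Summit.NavierStokesRegularity.NavierStokesRegularity.Theorems.TaylorModelCert

namespace QS2Text

/-- Decoder state: finished entries; the real part closed by `&` (`re`, `imSeen`); the rational being read (`mant`·2^`ex`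
/ denominator, `phase` 0 = mantissa digits, 1 = exponent digits, 2 = denominator digits; `acc`/`neg` the current integer;
`dirty` = an entry is open). [folklore] -/
structure St where
  items : Array QS2 := #[]
  re : ℚ := 0
  imSeen : Bool := false
  mant : ℤ := 0
  ex : ℤ := 0
  phase : ℕ := 0
  acc : ℕ := 0
  neg : Bool := false
  dirty : Bool := false

namespace St

/-- The integer read so far. [folklore] -/
def num (st : St) : ℤ := if st.neg then -(st.acc : ℤ) else st.acc

/-- The rational of the open token. [folklore] -/
def ratVal (st : St) : ℚ :=
  let mant : ℤ := if st.phase = 0 then st.num else st.mant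
  let ex : ℤ := if st.phase = 1 then st.num else st.ex
  let den : ℕ := if st.phase = 2 then st.acc else 1
  (mant : ℚ) * (2 : ℚ) ^ ex / (if den = 0 then (1 : ℚ) else (den : ℚ))

/-- Reset the token reader (keeping entries and the pending real part). [folklore] -/
def resetTok (st : St) : St := { st with mant := 0, ex := 0, phase := 0, acc := 0, neg := false }

/-- Close the open entry (if any). [folklore] -/
def endEntry (st : St) : St :=
  let r := st.ratVal
  let item : QS2 := if st.imSeen then ⟨st.re, r⟩ else ⟨r, 0⟩
  { st.resetTok with items := if st.dirty then st.items.push item else st.items, re := 0, imSeen := false, dirty := false }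

/-- Consume one character. [folklore] -/
def feed (st : St) (ch : Char) : St :=
  if ch.isDigit then { st with acc := st.acc * 10 + (ch.toNat - 48), dirty := true }
  else if ch = '-' then { st with neg := true, dirty := true }
  else if ch = '@' then { st with mant := st.num, acc := 0, neg := false, phase := 1, dirty := true }
  else if ch = '/' then
    (if st.phase = 0 then { st with mant := st.num, acc := 0, neg := false, phase := 2, dirty := true }
     else { st with ex := st.num, acc := 0, neg := false, phase := 2, dirty := true })
  else if ch = '&' then { st.resetTok with re := st.ratVal, imSeen := true, dirty := true }
  else if ch = ',' then st.endEntry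
  else st

end St

/-- Run the decoder over a string. [folklore] -/
def parse (s : String) : St := s.foldl St.feed {}

/-- `"A,A&B,…"` ↦ a list of elements of `ℚ(√2)`. [folklore] -/
def list (s : String) : List QS2 := (parse s).endEntry.items.toList

/-- `"A,A&B,…"` ↦ an array of elements of `ℚ(√2)`. [folklore] -/
def arr (s : String) : Array QS2 := (parse s).endEntry.items

end QS2Text

end Summit.NavierStokesRegularity.NavierStokesRegularity.Theorems.TaylorModelCert
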